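import Literature.Probability.LatticeModels.SRWHeatKernelLCLT
import Mathlib.Analysis.Calculus.MeanValue
import HarnessLib

/-!
# Unit-step differences of the heat kernel of the continuous-time simple random walk on `ℤ`:
# the DIFFERENCE version of the Gaussian-weighted local limit theorem (one factor `t^{-1/2}` better)

Topic `Probability/LatticeModels`, continuation of `SRWHeatKernel1D.lean` / `SRWHeatKernelLCLT.lean`
(objects `srwHeatKernel t m = q_t(m)`, `gaussHeatKernel t m = φ_t(m) = (2πt)^{-1/2}e^{-m²/2t}`, the entire
integrand `srwHeatIntegrand t m z = e^{izm}e^{-t(1 - cos z)}`, its contour shift, and the local limit theorem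
`|q_t(m) - φ_t(m)| ≤ B t^{-3/2}(1 + m²/t)^{-p}`).  PROVED here, by the SAME contour shift applied to the
differenced integrands `F_{t,m+1} - F_{t,m} = F_{t,m}·(e^{iz} - 1)` and `G_{t,m+1,λ} - G_{t,m,λ} = G_{t,m,λ}·(e^{iz} - 1)`
(`z = k + iλ`; the multiplier obeys `‖e^{i(k+iλ)} - 1‖ ≤ |k| + λ`, which is where the extra `t^{-1/2}` comes from):

* `srwHeatKernel_diff_lclt` : **for every `p : ℕ` a constant `B` with
  `|(q_t(m+1) - q_t(m)) - (φ_t(m+1) - φ_t(m))| ≤ B t⁻² (1 + m²/t)^{-p}` for all `t ≥ 1`, `m ∈ ℤ`**;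
* `gaussHeatKernel_diff_le` : `|φ_t(m+1) - φ_t(m)| ≤ C t⁻¹ (1 + m²/t)^{-p}` (`t ≥ 1`, real `m`; mean value
  inequality with `∂_yφ_t(y) = -(y/t)φ_t(y)`, `hasDerivAt_gaussHeatKernel`);
* the tools: `srwHeatIntegrand_succ` / `gaussShift_succ` (the multiplier), `norm_cexp_I_shift_sub_one_le`
  (`‖e^{i(k+iλ)} - 1‖ ≤ |k| + λ`), `pow_even_mul_exp_neg_le` (`k^{2j}e^{-αk²} ≤ j!(2/α)^j e^{-(α/2)k²}`),
  the AM–GM step `|k| ≤ (σk² + σ⁻¹)/2`, the pointwise bounds `norm_diff_integrand_sub_gauss_le` (on `|k| ≤ π`)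
  and `norm_diff_gaussShift_le_tail` (`|k| ≥ π`), the core `srwHeatKernel_diff_sub_gauss_core` (stated for
  `t = σ²`, `σ ≥ 1`, shift `0 ≤ λ ≤ 1`) and the two regimes `diff_lclt_gaussian_regime` (`λ = m/t`),
  `diff_lclt_poisson_regime` (`λ = 1`); negative `m` by the reflection `m ↦ -m-1`.

This is the one-dimensional input that upgrades the discrete-gradient asymptotics of the lattice Green
function (`LatticeGreenGradient.lean`: `∇ᵢG = a_d∂ᵢ|x|^{2-d} + O(|x|^{-d})`, Lawler 1991 Thm 1.5.5 (1.36)) to the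
sharp second-difference statement (1.37) (`O(|x|^{-d-1})`): in the product formula `G(x) = ∫₀^∞ ∏ᵢ q_t(xᵢ) dt`
a differenced factor now carries `t⁻¹` (kernel) resp. `t⁻²` (LCLT error) instead of `t^{-1/2}` resp. `t^{-3/2}`
(cf. Lawler 1991, Lemma 1.5.2 with (1.12)–(1.15), the discrete-time analogue).  Nothing here is specific to a
lattice model; no `def`, no hypothesis is introduced (theorem-only file).

## References

* G. F. Lawler, V. Limic, *Random Walk: A Modern Introduction*, CUP 2010, §2.3 (LCLT error estimates and their
  difference versions) [LawlerLimic2010].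
* G. F. Lawler, *Intersections of Random Walks*, Birkhäuser 1991, Lemma 1.5.2, (1.12)–(1.15), Thm 1.5.5
  [Lawler1991].

## Mathlib

Used: `Real.norm_exp_I_mul_ofReal_sub_one_le` (`‖e^{ix} - 1‖ ≤ |x|`), `Real.add_one_le_exp`,
`Real.pow_div_factorial_le_exp`, `integral_gaussian`, `Convex.norm_image_sub_le_of_norm_hasDerivWithin_le`;
everything about `q_t`, `φ_t` from the two tree files above.
-/

noncomputable section

open MeasureTheory Set Filter intervalIntegral
open scoped Real Topology

namespace Literature.Probability.LatticeModels

/-! ### The unit-step multiplier `e^{iz} - 1` -/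

/-- `F_{t,m+1}(z) = F_{t,m}(z) · e^{iz}`. [folklore] -/
theorem srwHeatIntegrand_succ (t : ℝ) (m : ℤ) (z : ℂ) :
    srwHeatIntegrand t (m + 1) z = srwHeatIntegrand t m z * Complex.exp (Complex.I * z) := by
  unfold srwHeatIntegrand
  push_cast
  rw [show Complex.I * z * ((m : ℂ) + 1) = Complex.I * z * m + Complex.I * z by ring, Complex.exp_add]
  ring

/-- `G_{t,m+1,λ}(k) = G_{t,m,λ}(k) · e^{i(k+iλ)}`. [folklore] -/
theorem gaussShift_succ (t : ℝ) (m : ℤ) (lam k : ℝ) :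
    Complex.exp (Complex.I * ((k : ℂ) + lam * Complex.I) * (((m + 1 : ℤ) : ℂ))) *
        Complex.exp (-(t : ℂ) * ((k : ℂ) + lam * Complex.I) ^ 2 / 2) =
      Complex.exp (Complex.I * ((k : ℂ) + lam * Complex.I) * m) *
        Complex.exp (-(t : ℂ) * ((k : ℂ) + lam * Complex.I) ^ 2 / 2) *
        Complex.exp (Complex.I * ((k : ℂ) + lam * Complex.I)) := by
  push_cast
  rw [show Complex.I * ((k : ℂ) + lam * Complex.I) * ((m : ℂ) + 1) =
      Complex.I * ((k : ℂ) + lam * Complex.I) * m + Complex.I * ((k : ℂ) + lam * Complex.I) by ring,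
    Complex.exp_add]
  ring

/-- **The multiplier is small near `k = 0`**: `‖e^{i(k+iλ)} - 1‖ ≤ |k| + λ` for `0 ≤ λ`
(`e^{i(k+iλ)} = e^{-λ}e^{ik}`, `‖e^{ik} - 1‖ ≤ |k|`, `1 - e^{-λ} ≤ λ`). [folklore] -/
theorem norm_cexp_I_shift_sub_one_le (k : ℝ) {lam : ℝ} (hl0 : 0 ≤ lam) :
    ‖Complex.exp (Complex.I * ((k : ℂ) + lam * Complex.I)) - 1‖ ≤ |k| + lam := by
  have hI2 : Complex.I * ((k : ℂ) + lam * Complex.I) = ((-lam : ℝ) : ℂ) + Complex.I * k := by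
    push_cast
    ring_nf
    rw [Complex.I_sq]
    ring
  rw [hI2, Complex.exp_add]
  set a : ℂ := Complex.exp ((-lam : ℝ) : ℂ) with ha
  set b : ℂ := Complex.exp (Complex.I * k) with hb
  have ha' : a = ((Real.exp (-lam) : ℝ) : ℂ) := by rw [ha, Complex.ofReal_exp]
  have hna : ‖a‖ = Real.exp (-lam) := by rw [ha', Complex.norm_real, Real.norm_eq_abs, abs_of_pos (Real.exp_pos _)]
  have hexp1 : Real.exp (-lam) ≤ 1 := by rw [Real.exp_le_one_iff]; linarith
  have hexp2 : 1 - Real.exp (-lam) ≤ lam := by linarith [Real.add_one_le_exp (-lam)]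
  have hb1 : ‖b - 1‖ ≤ |k| := by
    have := Real.norm_exp_I_mul_ofReal_sub_one_le (x := k)
    simpa [hb, Real.norm_eq_abs] using this
  have e : a * b - 1 = a * (b - 1) + (a - 1) := by ring
  rw [e]
  calc ‖a * (b - 1) + (a - 1)‖ ≤ ‖a * (b - 1)‖ + ‖a - 1‖ := norm_add_le _ _
    _ = ‖a‖ * ‖b - 1‖ + ‖a - 1‖ := by rw [norm_mul]
    _ ≤ 1 * |k| + lam := by
        refine add_le_add (mul_le_mul (hna ▸ hexp1) hb1 (norm_nonneg _) zero_le_one) ?_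
        rw [ha', ← Complex.ofReal_one, ← Complex.ofReal_sub, Complex.norm_real, Real.norm_eq_abs,
          abs_of_nonpos (by linarith)]
        linarith
    _ = |k| + lam := by ring

/-! ### Even Gaussian moments -/

/-- `k^{2j} e^{-αk²} ≤ j!(2/α)^j e^{-(α/2)k²}` for `α > 0` (from `y^j/j! ≤ e^y` at `y = αk²/2`);
`j = 2` is `SRWHeatKernelLCLT.pow_four_mul_exp_neg_le`. [folklore] -/
theorem pow_even_mul_exp_neg_le (j : ℕ) {α : ℝ} (hα : 0 < α) (k : ℝ) :
    k ^ (2 * j) * Real.exp (-α * k ^ 2) ≤ j.factorial * (2 / α) ^ j * Real.exp (-(α / 2) * k ^ 2) := by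
  have hy : 0 ≤ α * k ^ 2 / 2 := by positivity
  have h := Real.pow_div_factorial_le_exp (hx := hy) (n := j)
  have hf : (0 : ℝ) < j.factorial := by exact_mod_cast Nat.factorial_pos j
  rw [div_le_iff₀ hf] at h
  -- `h : (αk²/2)^j ≤ e^{αk²/2} · j!`
  have e1 : k ^ (2 * j) = (2 / α) ^ j * (α * k ^ 2 / 2) ^ j := by
    rw [← mul_pow, pow_mul]; congr 1; field_simp
  have e2 : Real.exp (-α * k ^ 2) = Real.exp (-(α / 2) * k ^ 2) * Real.exp (-(α * k ^ 2 / 2)) := by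
    rw [← Real.exp_add]; congr 1; ring
  have e3 : Real.exp (α * k ^ 2 / 2) * Real.exp (-(α * k ^ 2 / 2)) = 1 := by
    rw [← Real.exp_add]; simp
  rw [e1, e2]
  calc (2 / α) ^ j * (α * k ^ 2 / 2) ^ j * (Real.exp (-(α / 2) * k ^ 2) * Real.exp (-(α * k ^ 2 / 2)))
      ≤ (2 / α) ^ j * (Real.exp (α * k ^ 2 / 2) * j.factorial) *
          (Real.exp (-(α / 2) * k ^ 2) * Real.exp (-(α * k ^ 2 / 2))) := by gcongr
    _ = j.factorial * (2 / α) ^ j * Real.exp (-(α / 2) * k ^ 2) *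
          (Real.exp (α * k ^ 2 / 2) * Real.exp (-(α * k ^ 2 / 2))) := by ring
    _ = j.factorial * (2 / α) ^ j * Real.exp (-(α / 2) * k ^ 2) := by rw [e3, mul_one]

/-! ### The Gaussian kernel: derivative and unit-step difference -/

/-- `∂_y φ_t(y) = -(y/t) φ_t(y)` (`t > 0`). [folklore] -/
theorem hasDerivAt_gaussHeatKernel {t : ℝ} (ht : 0 < t) (y : ℝ) :
    HasDerivAt (fun y : ℝ => gaussHeatKernel t y) (-(y / t) * gaussHeatKernel t y) y := by
  have h0 : HasDerivAt (fun y : ℝ => y ^ 2 / (2 * t)) (((2 : ℕ) : ℝ) * y ^ (2 - 1) * 1 / (2 * t)) y :=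
    ((hasDerivAt_id y).pow 2).div_const (2 * t)
  have h1 : HasDerivAt (fun y : ℝ => -(y ^ 2 / (2 * t))) (-(((2 : ℕ) : ℝ) * y ^ (2 - 1) * 1 / (2 * t))) y :=
    h0.neg
  have h2 := (h1.exp).div_const (Real.sqrt (2 * π * t))
  have hs : Real.sqrt (2 * π * t) ≠ 0 := (Real.sqrt_pos.2 (by positivity)).ne'
  have e : Real.exp (-(y ^ 2 / (2 * t))) * -(((2 : ℕ) : ℝ) * y ^ (2 - 1) * 1 / (2 * t)) / Real.sqrt (2 * π * t) =
      -(y / t) * gaussHeatKernel t y := by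
    unfold gaussHeatKernel
    field_simp
    push_cast
    ring
  rw [e] at h2
  exact h2

/-- Neighbouring weights are comparable: `(1 + m²/t) ≤ 3(1 + y²/t)` for `|y - m| ≤ 1`, `t ≥ 1`.
[folklore] -/
theorem one_add_sq_div_le_three_mul {t m y : ℝ} (ht : 1 ≤ t) (h : |y - m| ≤ 1) :
    1 + m ^ 2 / t ≤ 3 * (1 + y ^ 2 / t) := by
  have ht0 : 0 < t := by linarith
  have hd := abs_le.1 h
  have hm2 : m ^ 2 ≤ 2 * y ^ 2 + 2 := by nlinarith [sq_nonneg (y - m), sq_nonneg (y + (y - m))]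
  rw [show 3 * (1 + y ^ 2 / t) = 3 + 3 * y ^ 2 / t by ring]
  have h1 : m ^ 2 / t ≤ (2 * y ^ 2 + 2) / t := div_le_div_of_nonneg_right hm2 ht0.le
  have h2 : (2 * y ^ 2 + 2) / t = 2 * y ^ 2 / t + 2 / t := by ring
  have h3 : 2 / t ≤ 2 := by rw [div_le_iff₀ ht0]; linarith
  have h4 : 0 ≤ y ^ 2 / t := by positivity
  have h5 : 2 * y ^ 2 / t = 2 * (y ^ 2 / t) := by ring
  have h6 : 3 * y ^ 2 / t = 3 * (y ^ 2 / t) := by ring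
  rw [h5] at h2
  rw [h6]
  linarith

/-- **Unit-step difference of the Gaussian kernel**: for every `p : ℕ` there is `C > 0` with
`|φ_t(m+1) - φ_t(m)| ≤ C t⁻¹ (1 + m²/t)^{-p}` for all `t ≥ 1` and all real `m` (mean value inequality with
`|∂_yφ_t(y)| = (|y|/t)φ_t(y) ≤ 2^{p+1}(p+1)!e^{1/2} t⁻¹ (1 + y²/t)^{-p}` and the weight comparison). [folklore] -/
theorem gaussHeatKernel_diff_le (p : ℕ) : ∃ C : ℝ, 0 < C ∧ ∀ t : ℝ, 1 ≤ t → ∀ m : ℝ,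
    |gaussHeatKernel t (m + 1) - gaussHeatKernel t m| ≤ C * t⁻¹ * ((1 + m ^ 2 / t) ^ p)⁻¹ := by
  set C₀ : ℝ := 2 ^ (p + 1) * (p + 1).factorial * Real.exp (1 / 2) with hC₀
  have hC₀0 : 0 < C₀ := by positivity
  refine ⟨3 ^ p * C₀, by positivity, fun t ht m => ?_⟩
  have ht0 : 0 < t := by linarith
  -- derivative bound on `[m, m+1]`
  have hderiv : ∀ y ∈ Icc m (m + 1), HasDerivWithinAt (fun y : ℝ => gaussHeatKernel t y)
      (-(y / t) * gaussHeatKernel t y) (Icc m (m + 1)) y :=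
    fun y _ => (hasDerivAt_gaussHeatKernel ht0 y).hasDerivWithinAt
  have hbound : ∀ y ∈ Icc m (m + 1), ‖-(y / t) * gaussHeatKernel t y‖ ≤
      3 ^ p * C₀ * t⁻¹ * ((1 + m ^ 2 / t) ^ p)⁻¹ := by
    intro y hy
    have hφ := gaussHeatKernel_le_weight (p + 1) ht0 y
    have hφ0 := gaussHeatKernel_nonneg t y
    have hw0 : 0 < 1 + y ^ 2 / t := by positivity
    have hwm : 0 < 1 + m ^ 2 / t := by positivity
    rw [Real.norm_eq_abs, abs_mul, abs_neg, abs_div, abs_of_pos ht0, abs_of_nonneg hφ0]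
    -- `|y| t^{-1/2} ≤ 1 + y²/t`
    have hτ : 0 < t ^ (-(1 / 2 : ℝ)) := Real.rpow_pos_of_pos ht0 _
    have hτ2 : (t ^ (-(1 / 2 : ℝ))) ^ 2 = t⁻¹ := by
      rw [Real.rpow_neg ht0.le, ← Real.sqrt_eq_rpow, inv_pow, Real.sq_sqrt ht0.le]
    have hv : |y| * t ^ (-(1 / 2 : ℝ)) ≤ 1 + y ^ 2 / t := by
      have h1 : 0 ≤ (|y| * t ^ (-(1 / 2 : ℝ)) - 1) ^ 2 := sq_nonneg _
      have h2 : (|y| * t ^ (-(1 / 2 : ℝ))) ^ 2 = y ^ 2 / t := by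
        rw [mul_pow, sq_abs, hτ2, div_eq_mul_inv]
      nlinarith
    -- assemble
    have hcmp : ((1 + y ^ 2 / t) ^ p)⁻¹ ≤ 3 ^ p * ((1 + m ^ 2 / t) ^ p)⁻¹ := by
      have hym : |y - m| ≤ 1 := by rw [abs_le]; constructor <;> linarith [hy.1, hy.2]
      have h3 := one_add_sq_div_le_three_mul ht hym
      rw [← inv_pow, ← inv_pow, ← mul_pow]
      apply pow_le_pow_left₀ (by positivity)
      rw [inv_le_iff_one_le_mul₀ hw0]
      calc (1 : ℝ) = (1 + m ^ 2 / t)⁻¹ * (1 + m ^ 2 / t) := by field_simp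
        _ ≤ (1 + m ^ 2 / t)⁻¹ * (3 * (1 + y ^ 2 / t)) := by gcongr
        _ = 3 * (1 + m ^ 2 / t)⁻¹ * (1 + y ^ 2 / t) := by ring
    calc |y| / t * gaussHeatKernel t y
        ≤ |y| / t * (C₀ * t ^ (-(1 / 2 : ℝ)) * ((1 + y ^ 2 / t) ^ (p + 1))⁻¹) := by
          refine mul_le_mul_of_nonneg_left ?_ (by positivity)
          simpa only [hC₀] using hφ
      _ = C₀ * t⁻¹ * ((|y| * t ^ (-(1 / 2 : ℝ))) * (1 + y ^ 2 / t)⁻¹) * ((1 + y ^ 2 / t) ^ p)⁻¹ := by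
          rw [pow_succ, mul_inv]
          field_simp
      _ ≤ C₀ * t⁻¹ * 1 * ((1 + y ^ 2 / t) ^ p)⁻¹ := by
          gcongr
          rw [mul_inv_le_iff₀ hw0, one_mul]
          exact hv
      _ ≤ C₀ * t⁻¹ * 1 * (3 ^ p * ((1 + m ^ 2 / t) ^ p)⁻¹) := by gcongr
      _ = 3 ^ p * C₀ * t⁻¹ * ((1 + m ^ 2 / t) ^ p)⁻¹ := by ring
  have h := Convex.norm_image_sub_le_of_norm_hasDerivWithin_le hderiv hbound (convex_Icc m (m + 1))
    (left_mem_Icc.2 (by linarith)) (right_mem_Icc.2 (by linarith))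
  rw [Real.norm_eq_abs, Real.norm_eq_abs, show m + 1 - m = (1 : ℝ) by ring, abs_one, mul_one] at h
  exact h

/-! ### The core difference estimate (`t = σ²`, `σ ≥ 1`) -/

/-- Square-root bookkeeping: for `σ > 0`, `(σ²)^{-1/2} = σ⁻¹`. [folklore] -/
theorem sq_rpow_neg_half_eq_inv {σ : ℝ} (hσ : 0 < σ) : (σ ^ 2) ^ (-(1 / 2 : ℝ)) = σ⁻¹ := by
  rw [Real.rpow_neg (by positivity), ← Real.sqrt_eq_rpow, Real.sqrt_sq hσ.le]

/-- `√(8π) ≤ 6` and `e^{-u} ≤ u⁻¹` bookkeeping for the tail: `e^{-π²σ²/4} · (8/σ²) · √(π/(σ²/8)) ≤ 22 σ⁻⁴`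
for `σ ≥ 1`. [folklore] -/
theorem tail_const_le {σ : ℝ} (hσ : 1 ≤ σ) :
    Real.exp (-(π ^ 2 * σ ^ 2 / 4)) * (8 / σ ^ 2) * Real.sqrt (π / (σ ^ 2 / 8)) ≤ 22 * (σ ^ 2)⁻¹ ^ 2 := by
  have hσ0 : 0 < σ := by linarith
  have hπ := Real.pi_pos
  have hπ3 := Real.pi_gt_three
  have hu : 0 < π ^ 2 * σ ^ 2 / 4 := by positivity
  have hexp : Real.exp (-(π ^ 2 * σ ^ 2 / 4)) ≤ (π ^ 2 * σ ^ 2 / 4)⁻¹ := by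
    have h1 : π ^ 2 * σ ^ 2 / 4 + 1 ≤ Real.exp (π ^ 2 * σ ^ 2 / 4) := Real.add_one_le_exp _
    rw [Real.exp_neg, inv_le_inv₀ (Real.exp_pos _) hu]
    linarith
  have hsqrt : Real.sqrt (π / (σ ^ 2 / 8)) = Real.sqrt (8 * π) * σ⁻¹ := by
    rw [show π / (σ ^ 2 / 8) = (8 * π) * (σ ^ 2)⁻¹ by field_simp, Real.sqrt_mul (by positivity),
      Real.sqrt_inv, Real.sqrt_sq hσ0.le]
  have h8π : Real.sqrt (8 * π) ≤ 6 := by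
    rw [Real.sqrt_le_left (by norm_num)]; nlinarith [Real.pi_le_four]
  rw [hsqrt]
  have hσinv : σ⁻¹ ≤ 1 := inv_le_one_of_one_le₀ hσ
  calc Real.exp (-(π ^ 2 * σ ^ 2 / 4)) * (8 / σ ^ 2) * (Real.sqrt (8 * π) * σ⁻¹)
      ≤ (π ^ 2 * σ ^ 2 / 4)⁻¹ * (8 / σ ^ 2) * (6 * 1) := by gcongr
    _ = (192 / π ^ 2) * (σ ^ 2)⁻¹ ^ 2 := by field_simp; ring
    _ ≤ 22 * (σ ^ 2)⁻¹ ^ 2 := by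
        refine mul_le_mul_of_nonneg_right ?_ (by positivity)
        have h9 : 9 < π ^ 2 := by nlinarith
        rw [div_le_iff₀ (by positivity)]
        linarith

/-- **Pointwise comparison of the DIFFERENCED integrands** on `|k| ≤ π`: for `t > 0`, `0 ≤ λ ≤ 1`, any
auxiliary `σ > 0` (later `σ = √t`) and `m ∈ ℤ`,
`‖(F_{t,m+1} - F_{t,m})(k+iλ) - (G_{t,m+1,λ} - G_{t,m,λ})(k)‖ ≤ e^{-λm}e^{(7/8)tλ²}·8e⁵t·P(σ,t,λ)·e^{-(t/π²)k²}`,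
`P = (σ/2)·6π⁶t⁻³ + (σ⁻¹/2 + λ)·2π⁴t⁻² + (σλ⁴/2)·π²t⁻¹ + (σ⁻¹/2 + λ)λ⁴`: the common factor `e^{i(k+iλ)} - 1`
(`‖·‖ ≤ |k| + λ ≤ (σk² + σ⁻¹)/2 + λ`) times `SRWHeatKernelLCLT.norm_srwHeatIntegrand_sub_gauss_le`, the even
moments absorbed by `pow_even_mul_exp_neg_le` (`α = 2t/π²`, `2/α = π²/t`). [folklore] -/
theorem norm_diff_integrand_sub_gauss_le {t σ k lam : ℝ} (ht : 0 < t) (hσ : 0 < σ) (hk : |k| ≤ π)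
    (hl0 : 0 ≤ lam) (hl1 : lam ≤ 1) (m : ℤ) :
    ‖(srwHeatIntegrand t (m + 1) ((k : ℂ) + lam * Complex.I) - srwHeatIntegrand t m ((k : ℂ) + lam * Complex.I)) -
        (Complex.exp (Complex.I * ((k : ℂ) + lam * Complex.I) * (((m + 1 : ℤ) : ℂ))) *
            Complex.exp (-(t : ℂ) * ((k : ℂ) + lam * Complex.I) ^ 2 / 2) -
          Complex.exp (Complex.I * ((k : ℂ) + lam * Complex.I) * m) *
            Complex.exp (-(t : ℂ) * ((k : ℂ) + lam * Complex.I) ^ 2 / 2))‖ ≤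
      Real.exp (-(lam * m)) * Real.exp (7 / 8 * t * lam ^ 2) * (8 * Real.exp 5 * t) *
        (σ / 2 * (6 * π ^ 6 * t⁻¹ ^ 3) + (σ⁻¹ / 2 + lam) * (2 * π ^ 4 * t⁻¹ ^ 2) +
          σ * lam ^ 4 / 2 * (π ^ 2 * t⁻¹) + (σ⁻¹ / 2 + lam) * lam ^ 4) * Real.exp (-(t / π ^ 2) * k ^ 2) := by
  have hl : |lam| ≤ 1 := abs_le.2 ⟨by linarith, hl1⟩
  have hπ := Real.pi_pos
  set z : ℂ := (k : ℂ) + lam * Complex.I with hz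
  set F₀ : ℂ := srwHeatIntegrand t m z with hF₀
  set G₀ : ℂ := Complex.exp (Complex.I * z * m) * Complex.exp (-(t : ℂ) * z ^ 2 / 2) with hG₀
  set Mu : ℂ := Complex.exp (Complex.I * z) with hMu
  set P : ℝ := σ / 2 * (6 * π ^ 6 * t⁻¹ ^ 3) + (σ⁻¹ / 2 + lam) * (2 * π ^ 4 * t⁻¹ ^ 2) +
    σ * lam ^ 4 / 2 * (π ^ 2 * t⁻¹) + (σ⁻¹ / 2 + lam) * lam ^ 4 with hP
  have hF₁ : srwHeatIntegrand t (m + 1) z = F₀ * Mu := srwHeatIntegrand_succ t m z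
  have hG₁ : Complex.exp (Complex.I * z * (((m + 1 : ℤ) : ℂ))) * Complex.exp (-(t : ℂ) * z ^ 2 / 2) = G₀ * Mu :=
    gaussShift_succ t m lam k
  have e : (srwHeatIntegrand t (m + 1) z - F₀) -
      (Complex.exp (Complex.I * z * (((m + 1 : ℤ) : ℂ))) * Complex.exp (-(t : ℂ) * z ^ 2 / 2) - G₀) =
      (F₀ - G₀) * (Mu - 1) := by rw [hF₁, hG₁]; ring
  rw [e, norm_mul]
  have hFG : ‖F₀ - G₀‖ ≤ Real.exp (-(lam * m)) * (8 * Real.exp 5 * t * (k ^ 4 + lam ^ 4)) *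
      Real.exp (-(2 * t / π ^ 2) * k ^ 2 + 7 / 8 * t * lam ^ 2) :=
    norm_srwHeatIntegrand_sub_gauss_le ht.le hk hl m
  -- AM–GM: `|k| ≤ (σk² + σ⁻¹)/2`
  have hamgm : |k| ≤ (σ * k ^ 2 + σ⁻¹) / 2 := by
    have h1 : 0 ≤ (σ * |k| - 1) ^ 2 := sq_nonneg _
    have h2 : σ * |k| ^ 2 = σ * k ^ 2 := by rw [sq_abs]
    have h3 : σ⁻¹ * (σ * |k| - 1) ^ 2 = σ * k ^ 2 - 2 * |k| + σ⁻¹ := by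
      field_simp
      rw [← h2]
      ring
    have h4 : 0 ≤ σ⁻¹ * (σ * |k| - 1) ^ 2 := by positivity
    linarith
  have hMk : ‖Mu - 1‖ ≤ (σ * k ^ 2 + σ⁻¹) / 2 + lam :=
    (norm_cexp_I_shift_sub_one_le k hl0).trans (by linarith)
  -- even moments against `e^{-αk²}`, `α = 2t/π²`, `2/α = π²/t`
  have hα : (0 : ℝ) < 2 * t / π ^ 2 := by positivity
  have h2α : 2 / (2 * t / π ^ 2) = π ^ 2 * t⁻¹ := by field_simp
  have hα2 : -(2 * t / π ^ 2 / 2) = -(t / π ^ 2) := by ring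
  have hmom : ∀ j : ℕ, k ^ (2 * j) * Real.exp (-(2 * t / π ^ 2) * k ^ 2) ≤
      j.factorial * (π ^ 2 * t⁻¹) ^ j * Real.exp (-(t / π ^ 2) * k ^ 2) := by
    intro j
    have h := pow_even_mul_exp_neg_le j hα k
    rwa [h2α, hα2] at h
  have f3 : ((Nat.factorial 3 : ℕ) : ℝ) = 6 := by norm_num [Nat.factorial]
  have f2 : ((Nat.factorial 2 : ℕ) : ℝ) = 2 := by norm_num [Nat.factorial]
  have f1 : ((Nat.factorial 1 : ℕ) : ℝ) = 1 := by norm_num [Nat.factorial]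
  have f0 : ((Nat.factorial 0 : ℕ) : ℝ) = 1 := by norm_num [Nat.factorial]
  have hm3 := hmom 3
  have hm2 := hmom 2
  have hm1 := hmom 1
  have hm0 := hmom 0
  rw [f3] at hm3
  rw [f2] at hm2
  rw [f1] at hm1
  rw [f0] at hm0
  have hkey : (k ^ 4 + lam ^ 4) * ((σ * k ^ 2 + σ⁻¹) / 2 + lam) * Real.exp (-(2 * t / π ^ 2) * k ^ 2) ≤
      P * Real.exp (-(t / π ^ 2) * k ^ 2) := by
    have expand : (k ^ 4 + lam ^ 4) * ((σ * k ^ 2 + σ⁻¹) / 2 + lam) * Real.exp (-(2 * t / π ^ 2) * k ^ 2) =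
        σ / 2 * (k ^ (2 * 3) * Real.exp (-(2 * t / π ^ 2) * k ^ 2)) +
        (σ⁻¹ / 2 + lam) * (k ^ (2 * 2) * Real.exp (-(2 * t / π ^ 2) * k ^ 2)) +
        σ * lam ^ 4 / 2 * (k ^ (2 * 1) * Real.exp (-(2 * t / π ^ 2) * k ^ 2)) +
        (σ⁻¹ / 2 + lam) * lam ^ 4 * (k ^ (2 * 0) * Real.exp (-(2 * t / π ^ 2) * k ^ 2)) := by ring
    have hs1 : 0 ≤ σ / 2 := by positivity
    have hs2 : 0 ≤ σ⁻¹ / 2 + lam := by positivity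
    have hs3 : 0 ≤ σ * lam ^ 4 / 2 := by positivity
    have hs4 : 0 ≤ (σ⁻¹ / 2 + lam) * lam ^ 4 := by positivity
    have i1 := mul_le_mul_of_nonneg_left hm3 hs1
    have i2 := mul_le_mul_of_nonneg_left hm2 hs2
    have i3 := mul_le_mul_of_nonneg_left hm1 hs3
    have i4 := mul_le_mul_of_nonneg_left hm0 hs4
    rw [expand]
    refine (add_le_add (add_le_add (add_le_add i1 i2) i3) i4).trans (le_of_eq ?_)
    rw [hP]
    ring
  rw [Real.exp_add] at hFG
  calc ‖F₀ - G₀‖ * ‖Mu - 1‖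
      ≤ (Real.exp (-(lam * m)) * (8 * Real.exp 5 * t * (k ^ 4 + lam ^ 4)) *
          (Real.exp (-(2 * t / π ^ 2) * k ^ 2) * Real.exp (7 / 8 * t * lam ^ 2))) *
          ((σ * k ^ 2 + σ⁻¹) / 2 + lam) := mul_le_mul hFG hMk (norm_nonneg _) (by positivity)
    _ = (Real.exp (-(lam * m)) * Real.exp (7 / 8 * t * lam ^ 2)) * (8 * Real.exp 5 * t) *
          ((k ^ 4 + lam ^ 4) * ((σ * k ^ 2 + σ⁻¹) / 2 + lam) * Real.exp (-(2 * t / π ^ 2) * k ^ 2)) := by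
        ring
    _ ≤ (Real.exp (-(lam * m)) * Real.exp (7 / 8 * t * lam ^ 2)) * (8 * Real.exp 5 * t) *
          (P * Real.exp (-(t / π ^ 2) * k ^ 2)) := by gcongr
    _ = _ := by rw [hP]; ring

/-- **Tail of the DIFFERENCED Gaussian integrand**: for `t > 0`, `π ≤ |k|`, `0 ≤ λ`,
`‖(G_{t,m+1,λ} - G_{t,m,λ})(k)‖ ≤ e^{-λm + tλ²/2} e^{-π²t/4} (8/t) e^{-(t/8)k²}`
(`|k| + λ ≤ k²` for `|k| ≥ π`, `k²e^{-(t/4)k²} ≤ (8/t)e^{-(t/8)k²}`). [folklore] -/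
theorem norm_diff_gaussShift_le_tail {t k : ℝ} (ht : 0 < t) (hk : π ≤ |k|) (m : ℤ) {lam : ℝ}
    (hl0 : 0 ≤ lam) (hl1 : lam ≤ 1) :
    ‖Complex.exp (Complex.I * ((k : ℂ) + lam * Complex.I) * (((m + 1 : ℤ) : ℂ))) *
          Complex.exp (-(t : ℂ) * ((k : ℂ) + lam * Complex.I) ^ 2 / 2) -
        Complex.exp (Complex.I * ((k : ℂ) + lam * Complex.I) * m) *
          Complex.exp (-(t : ℂ) * ((k : ℂ) + lam * Complex.I) ^ 2 / 2)‖ ≤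
      Real.exp (-(lam * m) + t * lam ^ 2 / 2) * Real.exp (-(π ^ 2 * t / 4)) * (8 / t) *
        Real.exp (-(t / 8) * k ^ 2) := by
  set z : ℂ := (k : ℂ) + lam * Complex.I with hz
  set G₀ : ℂ := Complex.exp (Complex.I * z * m) * Complex.exp (-(t : ℂ) * z ^ 2 / 2) with hG₀
  set Mu : ℂ := Complex.exp (Complex.I * z) with hMu
  have hG₁ : Complex.exp (Complex.I * z * (((m + 1 : ℤ) : ℂ))) * Complex.exp (-(t : ℂ) * z ^ 2 / 2) = G₀ * Mu :=
    gaussShift_succ t m lam k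
  have e : Complex.exp (Complex.I * z * (((m + 1 : ℤ) : ℂ))) * Complex.exp (-(t : ℂ) * z ^ 2 / 2) - G₀ =
      G₀ * (Mu - 1) := by rw [hG₁]; ring
  rw [e, norm_mul]
  have hG₀norm : ‖G₀‖ ≤ Real.exp (-(lam * m) + t * lam ^ 2 / 2) * Real.exp (-(π ^ 2 * t / 4)) *
      Real.exp (-(t / 4) * k ^ 2) := norm_gaussShift_le_tail ht.le hk m lam
  have hk2 : |k| + lam ≤ k ^ 2 := by
    have h3 : 3 < |k| := lt_of_lt_of_le Real.pi_gt_three hk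
    nlinarith [sq_abs k]
  have hMk : ‖Mu - 1‖ ≤ k ^ 2 := (norm_cexp_I_shift_sub_one_le k hl0).trans hk2
  have hm1' := pow_even_mul_exp_neg_le 1 (show 0 < t / 4 by positivity) k
  have f1 : ((Nat.factorial 1 : ℕ) : ℝ) = 1 := by norm_num [Nat.factorial]
  have e8 : (2 / (t / 4)) ^ 1 = 8 / t := by rw [pow_one]; field_simp; ring
  have e8' : -(t / 4 / 2) = -(t / 8) := by ring
  rw [f1, e8, e8', one_mul, show 2 * 1 = 2 by rfl] at hm1'
  calc ‖G₀‖ * ‖Mu - 1‖ ≤ (Real.exp (-(lam * m) + t * lam ^ 2 / 2) * Real.exp (-(π ^ 2 * t / 4)) *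
        Real.exp (-(t / 4) * k ^ 2)) * k ^ 2 :=
        mul_le_mul hG₀norm hMk (norm_nonneg _) (by positivity)
    _ = Real.exp (-(lam * m) + t * lam ^ 2 / 2) * Real.exp (-(π ^ 2 * t / 4)) *
        (k ^ 2 * Real.exp (-(t / 4) * k ^ 2)) := by ring
    _ ≤ Real.exp (-(lam * m) + t * lam ^ 2 / 2) * Real.exp (-(π ^ 2 * t / 4)) *
        (8 / t * Real.exp (-(t / 8) * k ^ 2)) := by gcongr
    _ = _ := by ring

/-- **The core comparison for the unit-step DIFFERENCE**: for `t = σ²`, `σ ≥ 1`, `m ∈ ℤ` and a shift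
`0 ≤ λ ≤ 1`,
`2π |(q_t(m+1) - q_t(m)) - (φ_t(m+1) - φ_t(m))| ≤ e^{-λm + (7/8)tλ²} ·
  (8e⁵π² [(3π⁶ + π⁴)t⁻² + ((π²+1)/2)λ⁴ + 2π⁴λσ⁻¹t⁻¹ + λ⁵σ] + 22t⁻²)`.
Same contour shift as `srwHeatKernel_sub_gauss_core` with the differenced integrands
(`norm_diff_integrand_sub_gauss_le` on `(-π,π]`, `norm_diff_gaussShift_le_tail` outside); the extra
factor `e^{i(k+iλ)} - 1` produces the gain `σ⁻¹ = t^{-1/2}`. [folklore] -/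
theorem srwHeatKernel_diff_sub_gauss_core {t σ : ℝ} (hσ : 1 ≤ σ) (hσt : σ ^ 2 = t) (m : ℤ) {lam : ℝ}
    (hl0 : 0 ≤ lam) (hl1 : lam ≤ 1) :
    2 * π * |(srwHeatKernel t (m + 1) - srwHeatKernel t m) -
        (gaussHeatKernel t (((m + 1 : ℤ) : ℝ)) - gaussHeatKernel t m)| ≤
      Real.exp (-(lam * m) + 7 / 8 * t * lam ^ 2) *
        (8 * Real.exp 5 * π ^ 2 * ((3 * π ^ 6 + π ^ 4) * t⁻¹ ^ 2 + (π ^ 2 + 1) / 2 * lam ^ 4 +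
            2 * π ^ 4 * lam * (σ⁻¹ * t⁻¹) + lam ^ 5 * σ) + 22 * t⁻¹ ^ 2) := by
  have hσ0 : 0 < σ := by linarith
  have ht1 : 1 ≤ t := by rw [← hσt]; nlinarith
  have ht0 : 0 < t := by linarith
  have hπ := Real.pi_pos
  have hle : (-π : ℝ) ≤ π := by linarith
  set s : Set ℝ := Ioc (-π) π with hs_def
  have hs : MeasurableSet s := measurableSet_Ioc
  set F : ℝ → ℂ := fun k => srwHeatIntegrand t (m + 1) ((k : ℂ) + lam * Complex.I) -
    srwHeatIntegrand t m ((k : ℂ) + lam * Complex.I) with hF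
  set G : ℝ → ℂ := fun k =>
    Complex.exp (Complex.I * ((k : ℂ) + lam * Complex.I) * (((m + 1 : ℤ) : ℂ))) *
        Complex.exp (-(t : ℂ) * ((k : ℂ) + lam * Complex.I) ^ 2 / 2) -
      Complex.exp (Complex.I * ((k : ℂ) + lam * Complex.I) * m) *
        Complex.exp (-(t : ℂ) * ((k : ℂ) + lam * Complex.I) ^ 2 / 2) with hG
  -- integrability and the two representations
  obtain ⟨hG₀int, hG₀val⟩ := integral_gaussShift ht0 m lam
  obtain ⟨hG₁int, hG₁val⟩ := integral_gaussShift ht0 (m + 1) lam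
  have hF₀cont : Continuous fun k : ℝ => srwHeatIntegrand t m ((k : ℂ) + lam * Complex.I) :=
    (differentiable_srwHeatIntegrand t m).continuous.comp (by fun_prop)
  have hF₁cont : Continuous fun k : ℝ => srwHeatIntegrand t (m + 1) ((k : ℂ) + lam * Complex.I) :=
    (differentiable_srwHeatIntegrand t (m + 1)).continuous.comp (by fun_prop)
  have hF₀i : IntegrableOn (fun k : ℝ => srwHeatIntegrand t m ((k : ℂ) + lam * Complex.I)) s :=
    (hF₀cont.integrableOn_Icc (a := -π) (b := π)).mono_set Ioc_subset_Icc_self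
  have hF₁i : IntegrableOn (fun k : ℝ => srwHeatIntegrand t (m + 1) ((k : ℂ) + lam * Complex.I)) s :=
    (hF₁cont.integrableOn_Icc (a := -π) (b := π)).mono_set Ioc_subset_Icc_self
  have hGint : Integrable G := hG₁int.sub hG₀int
  have hFi : IntegrableOn F s := hF₁i.sub hF₀i
  have hGi : IntegrableOn G s := hGint.integrableOn
  have hq₀ : ((2 * π * srwHeatKernel t m : ℝ) : ℂ) =
      ∫ k in s, srwHeatIntegrand t m ((k : ℂ) + lam * Complex.I) := by
    rw [← integral_srwHeatIntegrand, integral_srwHeatIntegrand_shift t m lam, intervalIntegral.integral_of_le hle]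
  have hq₁ : ((2 * π * srwHeatKernel t (m + 1) : ℝ) : ℂ) =
      ∫ k in s, srwHeatIntegrand t (m + 1) ((k : ℂ) + lam * Complex.I) := by
    rw [← integral_srwHeatIntegrand, integral_srwHeatIntegrand_shift t (m + 1) lam,
      intervalIntegral.integral_of_le hle]
  have hφ₀ := (integral_add_compl hs hG₀int).trans hG₀val
  have hφ₁ := (integral_add_compl hs hG₁int).trans hG₁val
  have hdiff : ((2 * π * ((srwHeatKernel t (m + 1) - srwHeatKernel t m) -
      (gaussHeatKernel t (((m + 1 : ℤ) : ℝ)) - gaussHeatKernel t m)) : ℝ) : ℂ) =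
      (∫ k in s, (F k - G k)) - ∫ k in sᶜ, G k := by
    have e : ((2 * π * ((srwHeatKernel t (m + 1) - srwHeatKernel t m) -
        (gaussHeatKernel t (((m + 1 : ℤ) : ℝ)) - gaussHeatKernel t m)) : ℝ) : ℂ) =
        (((2 * π * srwHeatKernel t (m + 1) : ℝ) : ℂ) - ((2 * π * srwHeatKernel t m : ℝ) : ℂ)) -
          (((2 * π * gaussHeatKernel t (((m + 1 : ℤ) : ℝ)) : ℝ) : ℂ) - ((2 * π * gaussHeatKernel t m : ℝ) : ℂ)) := by
      push_cast; ring
    rw [e, hq₀, hq₁, ← hφ₀, ← hφ₁, integral_sub hFi hGi, integral_sub hF₁i hF₀i,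
      integral_sub hG₁int.integrableOn hG₀int.integrableOn,
      integral_sub hG₁int.integrableOn hG₀int.integrableOn]
    ring
  have h2π : (0 : ℝ) < 2 * π := by positivity
  have hnorm : ‖((2 * π * ((srwHeatKernel t (m + 1) - srwHeatKernel t m) -
      (gaussHeatKernel t (((m + 1 : ℤ) : ℝ)) - gaussHeatKernel t m)) : ℝ) : ℂ)‖ =
      2 * π * |(srwHeatKernel t (m + 1) - srwHeatKernel t m) -
        (gaussHeatKernel t (((m + 1 : ℤ) : ℝ)) - gaussHeatKernel t m)| := by
    rw [Complex.norm_real, Real.norm_eq_abs, abs_mul, abs_of_pos h2π]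
  rw [← hnorm, hdiff]
  -- constants and dominating functions
  set E : ℝ := Real.exp (-(lam * m) + 7 / 8 * t * lam ^ 2) with hE
  have hE0 : 0 < E := Real.exp_pos _
  set P : ℝ := σ / 2 * (6 * π ^ 6 * t⁻¹ ^ 3) + (σ⁻¹ / 2 + lam) * (2 * π ^ 4 * t⁻¹ ^ 2) +
    σ * lam ^ 4 / 2 * (π ^ 2 * t⁻¹) + (σ⁻¹ / 2 + lam) * lam ^ 4 with hP
  have hP0 : 0 ≤ P := by positivity
  set C₁ : ℝ := E * (8 * Real.exp 5 * t) * P with hC₁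
  have hC₁0 : 0 ≤ C₁ := by positivity
  set C₂ : ℝ := Real.exp (-(lam * m) + t * lam ^ 2 / 2) * Real.exp (-(π ^ 2 * t / 4)) * (8 / t) with hC₂
  have hC₂0 : 0 ≤ C₂ := by positivity
  set b₁ : ℝ → ℝ := fun k => C₁ * Real.exp (-(t / π ^ 2) * k ^ 2) with hb₁
  set b₂ : ℝ → ℝ := fun k => C₂ * Real.exp (-(t / 8) * k ^ 2) with hb₂
  have hg₁ := integrable_exp_neg_mul_sq (show 0 < t / π ^ 2 by positivity)
  have hg₂ := integrable_exp_neg_mul_sq (show 0 < t / 8 by positivity)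
  have hb₁i : Integrable b₁ := hg₁.const_mul C₁
  have hb₂i : Integrable b₂ := hg₂.const_mul C₂
  have hb₁0 : ∀ k, 0 ≤ b₁ k := fun k => mul_nonneg hC₁0 (Real.exp_pos _).le
  have hb₂0 : ∀ k, 0 ≤ b₂ k := fun k => mul_nonneg hC₂0 (Real.exp_pos _).le
  -- `e^{-λm + tλ²/2} ≤ E`
  have hE2 : Real.exp (-(lam * m) + t * lam ^ 2 / 2) ≤ E := by
    rw [hE]
    refine Real.exp_le_exp.2 ?_
    have : 0 ≤ t * lam ^ 2 := mul_nonneg ht0.le (sq_nonneg lam)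
    linarith
  -- the algebra of the main constant
  have halg : C₁ * (π ^ 2 * σ⁻¹) = E * (8 * Real.exp 5 * π ^ 2 * ((3 * π ^ 6 + π ^ 4) * t⁻¹ ^ 2 +
      (π ^ 2 + 1) / 2 * lam ^ 4 + 2 * π ^ 4 * lam * (σ⁻¹ * t⁻¹) + lam ^ 5 * σ)) := by
    rw [hC₁, hP, ← hσt]
    field_simp
    ring
  -- pointwise bounds
  have h1 : ∀ k ∈ s, ‖F k - G k‖ ≤ b₁ k := by
    intro k hk
    have hkπ : |k| ≤ π := abs_le.2 ⟨hk.1.le, hk.2⟩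
    have h := norm_diff_integrand_sub_gauss_le ht0 hσ0 hkπ hl0 hl1 m
    have e : b₁ k = Real.exp (-(lam * m)) * Real.exp (7 / 8 * t * lam ^ 2) * (8 * Real.exp 5 * t) *
        P * Real.exp (-(t / π ^ 2) * k ^ 2) := by
      simp only [hb₁, hC₁, hE, Real.exp_add]
    rw [e]
    exact h
  have h2 : ∀ k ∈ sᶜ, ‖G k‖ ≤ b₂ k := by
    intro k hk
    have hk' : π ≤ |k| := by
      simp only [hs_def, mem_compl_iff, mem_Ioc, not_and_or, not_lt, not_le] at hk
      rcases hk with hk | hk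
      · rw [abs_of_nonpos (by linarith)]; linarith
      · rw [abs_of_pos (by linarith)]; linarith
    exact norm_diff_gaussShift_le_tail ht0 hk' m hl0 hl1
  -- the two integral bounds
  have hI1 : ‖∫ k in s, (F k - G k)‖ ≤ C₁ * (π ^ 2 * σ⁻¹) := by
    have hint := integral_exp_neg_div_pi_sq_le ht0
    rw [← hσt, sq_rpow_neg_half_eq_inv hσ0] at hint
    have hFGn : IntegrableOn (fun k => ‖F k - G k‖) s := (hFi.sub hGi).norm
    calc ‖∫ k in s, (F k - G k)‖ ≤ ∫ k in s, ‖F k - G k‖ := norm_integral_le_integral_norm _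
      _ ≤ ∫ k in s, b₁ k := setIntegral_mono_on hFGn hb₁i.integrableOn hs h1
      _ ≤ ∫ k, b₁ k := setIntegral_le_integral hb₁i (Eventually.of_forall hb₁0)
      _ = C₁ * ∫ k, Real.exp (-(t / π ^ 2) * k ^ 2) := integral_const_mul _ _
      _ ≤ C₁ * (π ^ 2 * σ⁻¹) := by rw [hσt] at hint; exact mul_le_mul_of_nonneg_left hint hC₁0
  have hI2 : ‖∫ k in sᶜ, G k‖ ≤ Real.exp (-(lam * m) + t * lam ^ 2 / 2) * (22 * t⁻¹ ^ 2) := by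
    have htc := tail_const_le hσ
    rw [hσt] at htc
    have hGn : IntegrableOn (fun k => ‖G k‖) sᶜ := hGint.norm.integrableOn
    calc ‖∫ k in sᶜ, G k‖ ≤ ∫ k in sᶜ, ‖G k‖ := norm_integral_le_integral_norm _
      _ ≤ ∫ k in sᶜ, b₂ k := setIntegral_mono_on hGn hb₂i.integrableOn hs.compl h2
      _ ≤ ∫ k, b₂ k := setIntegral_le_integral hb₂i (Eventually.of_forall hb₂0)
      _ = C₂ * ∫ k, Real.exp (-(t / 8) * k ^ 2) := integral_const_mul _ _
      _ = C₂ * Real.sqrt (π / (t / 8)) := by rw [integral_gaussian]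
      _ = Real.exp (-(lam * m) + t * lam ^ 2 / 2) *
            (Real.exp (-(π ^ 2 * t / 4)) * (8 / t) * Real.sqrt (π / (t / 8))) := by rw [hC₂]; ring
      _ ≤ Real.exp (-(lam * m) + t * lam ^ 2 / 2) * (22 * t⁻¹ ^ 2) :=
          mul_le_mul_of_nonneg_left htc (Real.exp_pos _).le
  calc ‖(∫ k in s, (F k - G k)) - ∫ k in sᶜ, G k‖
      ≤ ‖∫ k in s, (F k - G k)‖ + ‖∫ k in sᶜ, G k‖ := norm_sub_le _ _
    _ ≤ C₁ * (π ^ 2 * σ⁻¹) + Real.exp (-(lam * m) + t * lam ^ 2 / 2) * (22 * t⁻¹ ^ 2) := add_le_add hI1 hI2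
    _ ≤ C₁ * (π ^ 2 * σ⁻¹) + E * (22 * t⁻¹ ^ 2) := by gcongr
    _ = E * (8 * Real.exp 5 * π ^ 2 * ((3 * π ^ 6 + π ^ 4) * t⁻¹ ^ 2 + (π ^ 2 + 1) / 2 * lam ^ 4 +
          2 * π ^ 4 * lam * (σ⁻¹ * t⁻¹) + lam ^ 5 * σ) + 22 * t⁻¹ ^ 2) := by rw [halg]; ring

/-! ### The difference local limit theorem with Gaussian weights -/

/-- The Gaussian regime `0 ≤ m ≤ t` (`λ = m/t`, `t = σ²`, `σ ≥ 1`):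
`2π|Δq_t(m) - Δφ_t(m)|(1 + m²/t)^p ≤ K·8^{p+3}(p+3)!e^{1/8}·t⁻²`. [folklore] -/
theorem diff_lclt_gaussian_regime (p : ℕ) {t σ : ℝ} (hσ : 1 ≤ σ) (hσt : σ ^ 2 = t) {m : ℤ} (hm : 0 ≤ m)
    (hmt : (m : ℝ) ≤ t) :
    2 * π * |(srwHeatKernel t (m + 1) - srwHeatKernel t m) -
        (gaussHeatKernel t (((m + 1 : ℤ) : ℝ)) - gaussHeatKernel t m)| * (1 + (m : ℝ) ^ 2 / t) ^ p ≤
      (8 * Real.exp 5 * π ^ 2 * (3 * π ^ 6 + π ^ 4 + (π ^ 2 + 1) / 2 + π ^ 4 + 1 / 2) + 22) *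
        (8 ^ (p + 3) * (p + 3).factorial * Real.exp (1 / 8)) * t⁻¹ ^ 2 := by
  set K₀ : ℝ := 3 * π ^ 6 + π ^ 4 + (π ^ 2 + 1) / 2 + π ^ 4 + 1 / 2 with hK₀
  set K : ℝ := 8 * Real.exp 5 * π ^ 2 * K₀ + 22 with hK
  have hσ0 : 0 < σ := by linarith
  have ht1 : 1 ≤ t := by rw [← hσt]; nlinarith
  have ht0 : 0 < t := by linarith
  have hπ := Real.pi_pos
  have hm0 : (0 : ℝ) ≤ m := by exact_mod_cast hm
  set u : ℝ := (m : ℝ) ^ 2 / t with hu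
  have hu0 : 0 ≤ u := by positivity
  have hw : 0 < (1 + u) ^ p := by positivity
  have hti : 0 < t⁻¹ ^ 2 := by positivity
  have hl0 : 0 ≤ (m : ℝ) / t := by positivity
  have hl1 : (m : ℝ) / t ≤ 1 := (div_le_one ht0).2 hmt
  have eexp : -((m : ℝ) / t * m) + 7 / 8 * t * ((m : ℝ) / t) ^ 2 = -(u / 8) := by
    rw [hu]; field_simp; ring
  -- the bracket is `≤ K₀ (1+u)³ t⁻²`
  have hmσ : (m : ℝ) * σ⁻¹ ≤ (1 + u) / 2 := by
    have h1 : 0 ≤ ((m : ℝ) * σ⁻¹ - 1) ^ 2 := sq_nonneg _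
    have h2 : ((m : ℝ) * σ⁻¹) ^ 2 = u := by rw [hu, ← hσt, mul_pow, inv_pow]; field_simp
    have h3 : ((m : ℝ) * σ⁻¹ - 1) ^ 2 = ((m : ℝ) * σ⁻¹) ^ 2 - 2 * ((m : ℝ) * σ⁻¹) + 1 := by ring
    rw [h3, h2] at h1
    linarith
  have hl4 : ((m : ℝ) / t) ^ 4 = u ^ 2 * t⁻¹ ^ 2 := by rw [hu]; field_simp
  have hlσ : (m : ℝ) / t * (σ⁻¹ * t⁻¹) = ((m : ℝ) * σ⁻¹) * t⁻¹ ^ 2 := by field_simp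
  have hl5 : ((m : ℝ) / t) ^ 5 * σ = u ^ 2 * ((m : ℝ) * σ⁻¹) * t⁻¹ ^ 2 := by
    rw [hu, ← hσt]; field_simp
  have h1u3 : 1 + u ≤ (1 + u) ^ 3 := le_self_pow₀ (by linarith) (by norm_num)
  have h1u : (1 : ℝ) ≤ (1 + u) ^ 3 := by linarith
  have hu2 : u ^ 2 ≤ (1 + u) ^ 3 := by
    have e : (1 + u) ^ 3 = u ^ 2 + (1 + 3 * u + 2 * u ^ 2 + u ^ 3) := by ring
    have : 0 ≤ 1 + 3 * u + 2 * u ^ 2 + u ^ 3 := by positivity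
    linarith
  have hu1 : (1 + u) / 2 ≤ (1 + u) ^ 3 := by linarith
  have hu3 : u ^ 2 * ((1 + u) / 2) ≤ 1 / 2 * (1 + u) ^ 3 := by
    have e : (1 + u) ^ 2 = u ^ 2 + (1 + 2 * u) := by ring
    have h : u ^ 2 ≤ (1 + u) ^ 2 := by rw [e]; linarith
    have := mul_le_mul_of_nonneg_right h (show 0 ≤ (1 + u) / 2 by positivity)
    calc u ^ 2 * ((1 + u) / 2) ≤ (1 + u) ^ 2 * ((1 + u) / 2) := this
      _ = 1 / 2 * (1 + u) ^ 3 := by ring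
  have hbr : (3 * π ^ 6 + π ^ 4) * t⁻¹ ^ 2 + (π ^ 2 + 1) / 2 * ((m : ℝ) / t) ^ 4 +
      2 * π ^ 4 * ((m : ℝ) / t) * (σ⁻¹ * t⁻¹) + ((m : ℝ) / t) ^ 5 * σ ≤ K₀ * (1 + u) ^ 3 * t⁻¹ ^ 2 := by
    rw [hl4, mul_assoc (2 * π ^ 4), hlσ, hl5, hK₀]
    have a1 : (3 * π ^ 6 + π ^ 4) * t⁻¹ ^ 2 ≤ (3 * π ^ 6 + π ^ 4) * ((1 + u) ^ 3 * t⁻¹ ^ 2) := by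
      refine mul_le_mul_of_nonneg_left ?_ (by positivity)
      calc t⁻¹ ^ 2 = 1 * t⁻¹ ^ 2 := (one_mul _).symm
        _ ≤ (1 + u) ^ 3 * t⁻¹ ^ 2 := mul_le_mul_of_nonneg_right h1u hti.le
    have a2 : (π ^ 2 + 1) / 2 * (u ^ 2 * t⁻¹ ^ 2) ≤ (π ^ 2 + 1) / 2 * ((1 + u) ^ 3 * t⁻¹ ^ 2) := by
      refine mul_le_mul_of_nonneg_left (mul_le_mul_of_nonneg_right hu2 hti.le) (by positivity)
    have a3 : 2 * π ^ 4 * (((m : ℝ) * σ⁻¹) * t⁻¹ ^ 2) ≤ π ^ 4 * ((1 + u) ^ 3 * t⁻¹ ^ 2) := by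
      have h1 : ((m : ℝ) * σ⁻¹) * t⁻¹ ^ 2 ≤ ((1 + u) / 2) * t⁻¹ ^ 2 := mul_le_mul_of_nonneg_right hmσ hti.le
      have h2 : ((1 + u) / 2) * t⁻¹ ^ 2 ≤ ((1 + u) ^ 3 / 2) * t⁻¹ ^ 2 :=
        mul_le_mul_of_nonneg_right (by linarith) hti.le
      calc 2 * π ^ 4 * (((m : ℝ) * σ⁻¹) * t⁻¹ ^ 2) ≤ 2 * π ^ 4 * (((1 + u) ^ 3 / 2) * t⁻¹ ^ 2) :=
            mul_le_mul_of_nonneg_left (h1.trans h2) (by positivity)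
        _ = π ^ 4 * ((1 + u) ^ 3 * t⁻¹ ^ 2) := by ring
    have a4 : u ^ 2 * ((m : ℝ) * σ⁻¹) * t⁻¹ ^ 2 ≤ 1 / 2 * ((1 + u) ^ 3 * t⁻¹ ^ 2) := by
      have h1 : u ^ 2 * ((m : ℝ) * σ⁻¹) ≤ u ^ 2 * ((1 + u) / 2) := mul_le_mul_of_nonneg_left hmσ (by positivity)
      have h2 := mul_le_mul_of_nonneg_right (h1.trans hu3) hti.le
      calc u ^ 2 * ((m : ℝ) * σ⁻¹) * t⁻¹ ^ 2 ≤ 1 / 2 * (1 + u) ^ 3 * t⁻¹ ^ 2 := h2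
        _ = 1 / 2 * ((1 + u) ^ 3 * t⁻¹ ^ 2) := by ring
    refine (add_le_add (add_le_add (add_le_add a1 a2) a3) a4).trans (le_of_eq ?_)
    ring
  have hbr2 : 8 * Real.exp 5 * π ^ 2 * ((3 * π ^ 6 + π ^ 4) * t⁻¹ ^ 2 + (π ^ 2 + 1) / 2 * ((m : ℝ) / t) ^ 4 +
      2 * π ^ 4 * ((m : ℝ) / t) * (σ⁻¹ * t⁻¹) + ((m : ℝ) / t) ^ 5 * σ) + 22 * t⁻¹ ^ 2 ≤
      K * (1 + u) ^ 3 * t⁻¹ ^ 2 := by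
    have h22 : 22 * t⁻¹ ^ 2 ≤ 22 * ((1 + u) ^ 3 * t⁻¹ ^ 2) := by
      refine mul_le_mul_of_nonneg_left ?_ (by norm_num)
      calc t⁻¹ ^ 2 = 1 * t⁻¹ ^ 2 := (one_mul _).symm
        _ ≤ (1 + u) ^ 3 * t⁻¹ ^ 2 := mul_le_mul_of_nonneg_right h1u hti.le
    have h8 : 0 ≤ 8 * Real.exp 5 * π ^ 2 := by positivity
    calc _ ≤ 8 * Real.exp 5 * π ^ 2 * (K₀ * (1 + u) ^ 3 * t⁻¹ ^ 2) + 22 * ((1 + u) ^ 3 * t⁻¹ ^ 2) :=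
          add_le_add (mul_le_mul_of_nonneg_left hbr h8) h22
      _ = K * (1 + u) ^ 3 * t⁻¹ ^ 2 := by rw [hK]; ring
  have hw3 := one_add_pow_mul_exp_neg_le (p + 3) hu0
  have hK0 : 0 ≤ K := by positivity
  have hcore := srwHeatKernel_diff_sub_gauss_core hσ hσt m hl0 hl1
  rw [eexp] at hcore
  calc 2 * π * |(srwHeatKernel t (m + 1) - srwHeatKernel t m) -
        (gaussHeatKernel t (((m + 1 : ℤ) : ℝ)) - gaussHeatKernel t m)| * (1 + u) ^ p
      ≤ Real.exp (-(u / 8)) * (8 * Real.exp 5 * π ^ 2 * ((3 * π ^ 6 + π ^ 4) * t⁻¹ ^ 2 +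
          (π ^ 2 + 1) / 2 * ((m : ℝ) / t) ^ 4 + 2 * π ^ 4 * ((m : ℝ) / t) * (σ⁻¹ * t⁻¹) + ((m : ℝ) / t) ^ 5 * σ) +
          22 * t⁻¹ ^ 2) * (1 + u) ^ p := mul_le_mul_of_nonneg_right hcore hw.le
    _ ≤ Real.exp (-(u / 8)) * (K * (1 + u) ^ 3 * t⁻¹ ^ 2) * (1 + u) ^ p := by gcongr
    _ = K * ((1 + u) ^ (p + 3) * Real.exp (-(u / 8))) * t⁻¹ ^ 2 := by ring
    _ ≤ K * (8 ^ (p + 3) * (p + 3).factorial * Real.exp (1 / 8)) * t⁻¹ ^ 2 := by gcongr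

/-- The Poisson regime `m > t ≥ 1` (`λ = 1`, `t = σ²`, `σ ≥ 1`):
`2π|Δq_t(m) - Δφ_t(m)|(1 + m²/t)^p ≤ K′·2^{p+2}8^{2(p+2)}(2(p+2))!·t⁻²`. [folklore] -/
theorem diff_lclt_poisson_regime (p : ℕ) {t σ : ℝ} (hσ : 1 ≤ σ) (hσt : σ ^ 2 = t) {m : ℤ}
    (hmt : t < (m : ℝ)) :
    2 * π * |(srwHeatKernel t (m + 1) - srwHeatKernel t m) -
        (gaussHeatKernel t (((m + 1 : ℤ) : ℝ)) - gaussHeatKernel t m)| * (1 + (m : ℝ) ^ 2 / t) ^ p ≤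
      (8 * Real.exp 5 * π ^ 2 * (3 * π ^ 6 + π ^ 4 + (π ^ 2 + 1) / 2 + 2 * π ^ 4 + 1) + 22) *
        (2 ^ (p + 2) * 8 ^ (2 * (p + 2)) * (2 * (p + 2)).factorial) * t⁻¹ ^ 2 := by
  set K₁ : ℝ := 3 * π ^ 6 + π ^ 4 + (π ^ 2 + 1) / 2 + 2 * π ^ 4 + 1 with hK₁
  set K' : ℝ := 8 * Real.exp 5 * π ^ 2 * K₁ + 22 with hK'
  have hσ0 : 0 < σ := by linarith
  have ht1 : 1 ≤ t := by rw [← hσt]; nlinarith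
  have ht0 : 0 < t := by linarith
  have hπ := Real.pi_pos
  have hm1 : (1 : ℝ) ≤ m := by linarith
  set u : ℝ := (m : ℝ) ^ 2 / t with hu
  have hu0 : 0 ≤ u := by positivity
  have hw : 0 < (1 + u) ^ p := by positivity
  have hti : 0 < t⁻¹ ^ 2 := by positivity
  have hexp : Real.exp (-(1 * (m : ℝ)) + 7 / 8 * t * 1 ^ 2) ≤ Real.exp (-((m : ℝ) / 8)) := by
    rw [Real.exp_le_exp]
    simp only [one_pow, mul_one, one_mul]
    linarith
  -- the bracket is `≤ K₁ σ`, and `22 t⁻² ≤ 22 σ`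
  have htinv : t⁻¹ ≤ 1 := inv_le_one_of_one_le₀ ht1
  have hσinv : σ⁻¹ ≤ 1 := inv_le_one_of_one_le₀ hσ
  have hti1 : t⁻¹ ^ 2 ≤ 1 := pow_le_one₀ (by positivity) htinv
  have hbr : (3 * π ^ 6 + π ^ 4) * t⁻¹ ^ 2 + (π ^ 2 + 1) / 2 * (1 : ℝ) ^ 4 +
      2 * π ^ 4 * 1 * (σ⁻¹ * t⁻¹) + (1 : ℝ) ^ 5 * σ ≤ K₁ * σ := by
    rw [hK₁]
    simp only [one_pow, mul_one, one_mul]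
    have a1 : (3 * π ^ 6 + π ^ 4) * t⁻¹ ^ 2 ≤ (3 * π ^ 6 + π ^ 4) * σ := by
      refine mul_le_mul_of_nonneg_left (hti1.trans hσ) (by positivity)
    have a2 : (π ^ 2 + 1) / 2 ≤ (π ^ 2 + 1) / 2 * σ := le_mul_of_one_le_right (by positivity) hσ
    have a3 : 2 * π ^ 4 * (σ⁻¹ * t⁻¹) ≤ 2 * π ^ 4 * σ := by
      refine mul_le_mul_of_nonneg_left ?_ (by positivity)
      calc σ⁻¹ * t⁻¹ ≤ 1 * 1 := mul_le_mul hσinv htinv (by positivity) zero_le_one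
        _ ≤ σ := by linarith
    have a4 : σ ≤ 1 * σ := by rw [one_mul]
    refine (add_le_add (add_le_add (add_le_add a1 a2) a3) a4).trans (le_of_eq ?_)
    ring
  have hK₁0 : 0 ≤ K₁ := by positivity
  have hbr2 : 8 * Real.exp 5 * π ^ 2 * ((3 * π ^ 6 + π ^ 4) * t⁻¹ ^ 2 + (π ^ 2 + 1) / 2 * (1 : ℝ) ^ 4 +
      2 * π ^ 4 * 1 * (σ⁻¹ * t⁻¹) + (1 : ℝ) ^ 5 * σ) + 22 * t⁻¹ ^ 2 ≤ K' * σ := by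
    have h22 : 22 * t⁻¹ ^ 2 ≤ 22 * σ := mul_le_mul_of_nonneg_left (hti1.trans hσ) (by norm_num)
    have h8 : 0 ≤ 8 * Real.exp 5 * π ^ 2 := by positivity
    calc _ ≤ 8 * Real.exp 5 * π ^ 2 * (K₁ * σ) + 22 * σ := add_le_add (mul_le_mul_of_nonneg_left hbr h8) h22
      _ = K' * σ := by rw [hK']; ring
  have hK'0 : 0 ≤ K' := by positivity
  -- `σ · t² ≤ m³ ≤ (1+m²)²` and `1 + u ≤ 1 + m²`
  have hup : (1 + u) ^ p ≤ (1 + (m : ℝ) ^ 2) ^ p := by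
    apply pow_le_pow_left₀ (by positivity)
    rw [hu]
    exact add_le_add le_rfl (div_le_self (by positivity) ht1)
  have hσt2 : σ = t⁻¹ ^ 2 * (σ * t ^ 2) := by field_simp
  have hσt3 : σ * t ^ 2 ≤ (1 + (m : ℝ) ^ 2) ^ 2 := by
    have h1 : σ ≤ t := by rw [← hσt]; exact le_self_pow₀ hσ two_ne_zero
    have h2 : σ * t ^ 2 ≤ t ^ 3 := by
      calc σ * t ^ 2 ≤ t * t ^ 2 := mul_le_mul_of_nonneg_right h1 (by positivity)
        _ = t ^ 3 := by ring
    have h3 : t ^ 3 ≤ (m : ℝ) ^ 3 := pow_le_pow_left₀ ht0.le hmt.le 3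
    have h4 : (m : ℝ) ^ 3 ≤ (m : ℝ) ^ 4 := pow_le_pow_right₀ hm1 (by norm_num)
    have h5 : (m : ℝ) ^ 4 ≤ (1 + (m : ℝ) ^ 2) ^ 2 := by
      have e : (1 + (m : ℝ) ^ 2) ^ 2 = (m : ℝ) ^ 4 + (1 + 2 * (m : ℝ) ^ 2) := by ring
      have : 0 ≤ 1 + 2 * (m : ℝ) ^ 2 := by positivity
      linarith
    linarith
  have hw2 := one_add_sq_pow_mul_exp_neg_le (p + 2) hm1
  have hcore := srwHeatKernel_diff_sub_gauss_core hσ hσt m zero_le_one le_rfl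
  calc 2 * π * |(srwHeatKernel t (m + 1) - srwHeatKernel t m) -
        (gaussHeatKernel t (((m + 1 : ℤ) : ℝ)) - gaussHeatKernel t m)| * (1 + u) ^ p
      ≤ Real.exp (-(1 * (m : ℝ)) + 7 / 8 * t * 1 ^ 2) *
          (8 * Real.exp 5 * π ^ 2 * ((3 * π ^ 6 + π ^ 4) * t⁻¹ ^ 2 + (π ^ 2 + 1) / 2 * (1 : ℝ) ^ 4 +
            2 * π ^ 4 * 1 * (σ⁻¹ * t⁻¹) + (1 : ℝ) ^ 5 * σ) + 22 * t⁻¹ ^ 2) * (1 + u) ^ p :=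
        mul_le_mul_of_nonneg_right hcore hw.le
    _ ≤ Real.exp (-((m : ℝ) / 8)) * (K' * σ) * (1 + (m : ℝ) ^ 2) ^ p := by gcongr
    _ = Real.exp (-((m : ℝ) / 8)) * K' * t⁻¹ ^ 2 * ((σ * t ^ 2) * (1 + (m : ℝ) ^ 2) ^ p) := by
        have htne : t ≠ 0 := ht0.ne'
        field_simp
    _ ≤ Real.exp (-((m : ℝ) / 8)) * K' * t⁻¹ ^ 2 * ((1 + (m : ℝ) ^ 2) ^ 2 * (1 + (m : ℝ) ^ 2) ^ p) := by
        gcongr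
    _ = K' * ((1 + (m : ℝ) ^ 2) ^ (p + 2) * Real.exp (-((m : ℝ) / 8))) * t⁻¹ ^ 2 := by ring
    _ ≤ K' * (2 ^ (p + 2) * 8 ^ (2 * (p + 2)) * (2 * (p + 2)).factorial) * t⁻¹ ^ 2 := by gcongr

/-- **The Gaussian-weighted local limit theorem for UNIT-STEP DIFFERENCES** of the continuous-time
simple random walk on `ℤ`: for every `p : ℕ` there is `B > 0` with
`|(q_t(m+1) - q_t(m)) - (φ_t(m+1) - φ_t(m))| ≤ B t⁻² (1 + m²/t)^{-p}` for all `t ≥ 1`, `m ∈ ℤ` — one factor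
`t^{-1/2}` better than `srwHeatKernel_lclt`, as differencing should give.  Shift `λ = m/t` (`0 ≤ m ≤ t`),
`λ = 1` (`m > t`); negative `m` by the reflection `m ↦ -m-1` (`q`, `φ` even) at the cost of the weight
comparison `(1 + m²/t) ≤ 3(1 + (|m|-1)²/t)`.  This is the analytic input that upgrades discrete-GRADIENT
asymptotics of the lattice Green function from `O(|x|^{-d})` to `O(|x|^{-d-1})` (Lawler 1991 Thm 1.5.5 (1.37),
Lemma 1.5.2). [folklore] -/
theorem srwHeatKernel_diff_lclt (p : ℕ) : ∃ B : ℝ, 0 < B ∧ ∀ t : ℝ, 1 ≤ t → ∀ m : ℤ,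
    |(srwHeatKernel t (m + 1) - srwHeatKernel t m) - (gaussHeatKernel t ((m : ℝ) + 1) - gaussHeatKernel t m)| ≤
      B * t⁻¹ ^ 2 * ((1 + (m : ℝ) ^ 2 / t) ^ p)⁻¹ := by
  set KA : ℝ := (8 * Real.exp 5 * π ^ 2 * (3 * π ^ 6 + π ^ 4 + (π ^ 2 + 1) / 2 + π ^ 4 + 1 / 2) + 22) *
    (8 ^ (p + 3) * (p + 3).factorial * Real.exp (1 / 8)) with hKA
  set KB : ℝ := (8 * Real.exp 5 * π ^ 2 * (3 * π ^ 6 + π ^ 4 + (π ^ 2 + 1) / 2 + 2 * π ^ 4 + 1) + 22) *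
    (2 ^ (p + 2) * 8 ^ (2 * (p + 2)) * (2 * (p + 2)).factorial) with hKB
  have hπ := Real.pi_pos
  have hKA0 : 0 < KA := by positivity
  have hKB0 : 0 < KB := by positivity
  set B₀ : ℝ := max KA KB / (2 * π) with hB₀
  have hB₀0 : 0 < B₀ := by positivity
  refine ⟨3 ^ p * B₀, by positivity, ?_⟩
  -- the estimate for `m ≥ 0`, with constant `B₀`
  have H : ∀ t : ℝ, 1 ≤ t → ∀ m : ℤ, 0 ≤ m →
      |(srwHeatKernel t (m + 1) - srwHeatKernel t m) - (gaussHeatKernel t ((m : ℝ) + 1) - gaussHeatKernel t m)| ≤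
        B₀ * t⁻¹ ^ 2 * ((1 + (m : ℝ) ^ 2 / t) ^ p)⁻¹ := by
    intro t ht m hm
    have ht0 : 0 < t := by linarith
    set σ : ℝ := Real.sqrt t with hσ_def
    have hσ1 : 1 ≤ σ := by rw [hσ_def, show (1 : ℝ) = Real.sqrt 1 by simp]; exact Real.sqrt_le_sqrt ht
    have hσt : σ ^ 2 = t := Real.sq_sqrt ht0.le
    have hw : 0 < (1 + (m : ℝ) ^ 2 / t) ^ p := by positivity
    have h2π : 0 < 2 * π := by positivity
    have hcast : gaussHeatKernel t ((m : ℝ) + 1) = gaussHeatKernel t (((m + 1 : ℤ) : ℝ)) := by push_cast; rfl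
    rw [hcast, ← div_eq_mul_inv, le_div_iff₀ hw]
    have H2 : 2 * π * |(srwHeatKernel t (m + 1) - srwHeatKernel t m) -
        (gaussHeatKernel t (((m + 1 : ℤ) : ℝ)) - gaussHeatKernel t m)| * (1 + (m : ℝ) ^ 2 / t) ^ p ≤
        2 * π * B₀ * t⁻¹ ^ 2 := by
      have e : 2 * π * B₀ = max KA KB := by rw [hB₀]; field_simp
      rw [e]
      rcases le_or_gt (m : ℝ) t with hmt | hmt
      · calc _ ≤ KA * t⁻¹ ^ 2 := diff_lclt_gaussian_regime p hσ1 hσt hm hmt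
          _ ≤ max KA KB * t⁻¹ ^ 2 := by gcongr; exact le_max_left _ _
      · calc _ ≤ KB * t⁻¹ ^ 2 := diff_lclt_poisson_regime p hσ1 hσt hmt
          _ ≤ max KA KB * t⁻¹ ^ 2 := by gcongr; exact le_max_right _ _
    have := div_le_div_of_nonneg_right H2 h2π.le
    rw [show 2 * π * |(srwHeatKernel t (m + 1) - srwHeatKernel t m) -
        (gaussHeatKernel t (((m + 1 : ℤ) : ℝ)) - gaussHeatKernel t m)| * (1 + (m : ℝ) ^ 2 / t) ^ p / (2 * π) =
        |(srwHeatKernel t (m + 1) - srwHeatKernel t m) -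
        (gaussHeatKernel t (((m + 1 : ℤ) : ℝ)) - gaussHeatKernel t m)| * (1 + (m : ℝ) ^ 2 / t) ^ p by field_simp,
      show 2 * π * B₀ * t⁻¹ ^ 2 / (2 * π) = B₀ * t⁻¹ ^ 2 by field_simp] at this
    exact this
  intro t ht m
  have ht0 : 0 < t := by linarith
  have hti : 0 ≤ t⁻¹ ^ 2 := by positivity
  have h3p : (1 : ℝ) ≤ 3 ^ p := one_le_pow₀ (by norm_num)
  rcases le_or_gt 0 m with hm | hm
  · -- `m ≥ 0`: the constant `B₀ ≤ 3^p B₀`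
    refine (H t ht m hm).trans ?_
    have hw : 0 ≤ ((1 + (m : ℝ) ^ 2 / t) ^ p)⁻¹ := by positivity
    calc B₀ * t⁻¹ ^ 2 * ((1 + (m : ℝ) ^ 2 / t) ^ p)⁻¹ = 1 * (B₀ * t⁻¹ ^ 2 * ((1 + (m : ℝ) ^ 2 / t) ^ p)⁻¹) :=
          (one_mul _).symm
      _ ≤ 3 ^ p * (B₀ * t⁻¹ ^ 2 * ((1 + (m : ℝ) ^ 2 / t) ^ p)⁻¹) :=
          mul_le_mul_of_nonneg_right h3p (by positivity)
      _ = 3 ^ p * B₀ * t⁻¹ ^ 2 * ((1 + (m : ℝ) ^ 2 / t) ^ p)⁻¹ := by ring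
  · -- `m ≤ -1`: reflect to `n = -m-1 ≥ 0`
    set n : ℤ := -m - 1 with hn
    have hn0 : 0 ≤ n := by omega
    have h := H t ht n hn0
    have e1 : srwHeatKernel t (m + 1) = srwHeatKernel t n := by
      rw [← srwHeatKernel_neg t n]; congr 1; omega
    have e2 : srwHeatKernel t m = srwHeatKernel t (n + 1) := by
      rw [← srwHeatKernel_neg t (n + 1)]; congr 1; omega
    have e3 : gaussHeatKernel t ((m : ℝ) + 1) = gaussHeatKernel t n := by
      rw [← gaussHeatKernel_neg t n]; congr 1
      have : (m : ℝ) = -(n : ℝ) - 1 := by rw [hn]; push_cast; ring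
      rw [this]; ring
    have e4 : gaussHeatKernel t m = gaussHeatKernel t ((n : ℝ) + 1) := by
      rw [← gaussHeatKernel_neg t ((n : ℝ) + 1)]; congr 1
      rw [hn]; push_cast; ring
    rw [e1, e2, e3, e4]
    have eabs : |(srwHeatKernel t n - srwHeatKernel t (n + 1)) - (gaussHeatKernel t n - gaussHeatKernel t ((n : ℝ) + 1))| =
        |(srwHeatKernel t (n + 1) - srwHeatKernel t n) - (gaussHeatKernel t ((n : ℝ) + 1) - gaussHeatKernel t n)| := by
      rw [← abs_neg]; congr 1; ring
    rw [eabs]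
    refine h.trans ?_
    -- weight comparison `(1 + m²/t) ≤ 3 (1 + n²/t)` with `|m| = n + 1`
    have hcmp : ((1 + (n : ℝ) ^ 2 / t) ^ p)⁻¹ ≤ 3 ^ p * ((1 + (m : ℝ) ^ 2 / t) ^ p)⁻¹ := by
      have hwn : 0 < 1 + (n : ℝ) ^ 2 / t := by positivity
      have hwm : 0 < 1 + (m : ℝ) ^ 2 / t := by positivity
      have hym : |(n : ℝ) - ((n : ℝ) + 1)| ≤ 1 := by rw [show (n : ℝ) - ((n : ℝ) + 1) = -1 by ring]; norm_num
      have h3 := one_add_sq_div_le_three_mul ht hym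
      have hm2 : (m : ℝ) ^ 2 = ((n : ℝ) + 1) ^ 2 := by
        have : (m : ℝ) = -(n : ℝ) - 1 := by rw [hn]; push_cast; ring
        rw [this]; ring
      rw [hm2, ← inv_pow, ← inv_pow, ← mul_pow]
      apply pow_le_pow_left₀ (by positivity)
      rw [inv_le_iff_one_le_mul₀ hwn]
      have hwm' : 0 < 1 + ((n : ℝ) + 1) ^ 2 / t := by positivity
      calc (1 : ℝ) = (1 + ((n : ℝ) + 1) ^ 2 / t)⁻¹ * (1 + ((n : ℝ) + 1) ^ 2 / t) := by field_simp
        _ ≤ (1 + ((n : ℝ) + 1) ^ 2 / t)⁻¹ * (3 * (1 + (n : ℝ) ^ 2 / t)) := by gcongr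
        _ = 3 * (1 + ((n : ℝ) + 1) ^ 2 / t)⁻¹ * (1 + (n : ℝ) ^ 2 / t) := by ring
    calc B₀ * t⁻¹ ^ 2 * ((1 + (n : ℝ) ^ 2 / t) ^ p)⁻¹ ≤ B₀ * t⁻¹ ^ 2 * (3 ^ p * ((1 + (m : ℝ) ^ 2 / t) ^ p)⁻¹) :=
          mul_le_mul_of_nonneg_left hcmp (by positivity)
      _ = 3 ^ p * B₀ * t⁻¹ ^ 2 * ((1 + (m : ℝ) ^ 2 / t) ^ p)⁻¹ := by ring

end Literature.Probability.LatticeModels
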